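import Summits.ResolutionOfSingularities.ResolutionOfSingularities.Theorems.MarkedTransferCampaignW46MohWindowSurfacePermissible
import HarnessLib

/-!
# [OURS · L1 W4.6] THE CENTRE THREAD: an infinite permissible sequence with finite singular loci has an infinite BRANCH of singular
# points that is blown up infinitely often (cell res-hironaka, LADDER-RESOLUTION rung L, D-0089; seat res-L1-s46-pv-5 gen 5; host
# MarkedTransfer, `--supports stmt-ResolutionOfSingularities-16155 --as helper`)

HONEST FRAMING. Nothing here is a statement of H. Hironaka's manuscript [Hironaka2017] and nothing here asserts that any
statement of it holds. Pure combinatorics (KÖNIG's lemma on the forest of singular points) over the W4.6 vocabulary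
`CampaignW46.PermissibleRun` (res-L1-s46-pv-1) — regime-agnostic: the only hypothesis is that `Sing(E_k)` is a finite set of closed
points at every stage (`Regime.isolatedSing`, satisfied by `regimePlaneIsolated`, `Regime.mohWindowCurve`, `Regime.mohWindowSurface…`).
It is the reduction step «infinite sequence ⟹ infinite THREAD» that the heavy-side programme of rung (iii-2) (res-D-pv-008 /
res-D-pv-050: formal heavy thread → formal `p`-fold curve → exit) starts from; the successor file `…MohWindowSurfaceHeavyThread.lean`
adds «… and the thread is HEAVY infinitely often». AI-written; AI review is weaker than expert review. No `sorry`; axioms standard.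

WHAT IS PROVED.
* `PermissibleRun.base_mem_sing` — the image of a singular point of `E_{k+1}` is a singular point of `E_k`.
* `PermissibleRun.exists_centre_thread` — **CENTRE THREAD**: for a §2.1-permissible sequence `(Z_k, E_k, D_k, π_k)_k` with every
  `Sing(E_k)` a finite set of closed points there is a branch `b_k ∈ Sing(E_k)`, `π_k(b_{k+1}) = b_k`, such that `b_k` IS THE CENTRE
  (`D_k = {b_k}`) for infinitely many `k`. KÖNIG: the points `y ∈ Sing(E_k)` under infinitely many later centres form finite nonempty
  sets `T_k` mapped into each other; an «immortal» element (one under elements of every later `T_n`) exists in `T_0` and has an immortal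
  child (pigeonhole over the finite `T_{k+1}`); along the resulting branch, a tail avoiding the centres would be transported
  isomorphically (`MohWindow.injOn_preimage_compl`) and could not lie under any later centre. [ZariskiSamuel1960] (Kőnig 1927)
-/

noncomputable section

set_option linter.dupNamespace false -- mandated namespace of this single-conjunct summit

open CategoryTheory AlgebraicGeometry TopologicalSpace IsLocalRing

namespace Summit.ResolutionOfSingularities.ResolutionOfSingularities.Theorems

namespace CampaignW46

open Literature.AlgebraicGeometry.Resolution
open Literature.AlgebraicGeometry.Hironaka2017.S02Preliminaries
open Literature.AlgebraicGeometry.Hironaka2017.Datum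
open Scheme.IdealSheafData

universe u

variable {p : ℕ} [Fact p.Prime] {K : Type u} [Field K] [CharP K p]

/-- **The image of a singular point is singular** along a permissible sequence: for `y′ ∈ Sing(E_{k+1})`, `π_k y′ ∈ Sing(E_k)` (over
the centre: the centre lies in `Sing(E_k)`; off the centre: res-D-pv-050's `base_mem_sing_of_not_over_centre`). [folklore] -/
theorem PermissibleRun.base_mem_sing (r : PermissibleRun p K) (k : ℕ) {y' : (r.A (k + 1)).Z} (hy' : y' ∈ (r.E (k + 1)).sing) :
    (r.π k).base y' ∈ (r.E k).sing := by
  by_cases hover : (r.π k).base y' ∈ (r.D k : Set (r.A k).Z)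
  · exact (r.permissible k).subset_sing hover
  · rw [r.E_succ k] at hy'
    exact MohWindowSurfacePermissible.base_mem_sing_of_not_over_centre (r.π k) (r.blowup k) hy' hover

/-- **[OURS · L1 W4.6] THE CENTRE THREAD.** Let `r` be an (infinite) §2.1-permissible sequence all of whose singular loci `Sing(E_k)`
are finite sets of closed points. Then there is a BRANCH of singular points `b_k ∈ Sing(E_k)` with `π_k(b_{k+1}) = b_k` for all `k`
which is blown up infinitely often: for every `k₀` there is `k ≥ k₀` with `b_k ∈ D_k` (so `D_k = {b_k}`). KÖNIG's lemma on the
forest of singular points (module docstring). NOT a statement of the manuscript. [folklore] -/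
theorem PermissibleRun.exists_centre_thread (r : PermissibleRun p K) (hfin : ∀ k, (r.E k).sing.Finite)
    (hcl : ∀ k, (r.E k).sing ⊆ Literature.AlgebraicGeometry.Hironaka2017.S02Preliminaries.closedPoints (r.A k).Z) :
    ∃ b : ∀ k, (r.A k).Z, (∀ k, b k ∈ (r.E k).sing) ∧ (∀ k, (r.π k).base (b (k + 1)) = b k) ∧
      ∀ k₀, ∃ k, k₀ ≤ k ∧ b k ∈ (r.D k : Set (r.A k).Z) := by
  classical
  -- the centre points
  have hcentre : ∀ k, ∃ ξ : (r.A k).Z, ξ ∈ (r.E k).sing ∧ ((r.D k : Set (r.A k).Z) = {ξ}) := fun k => by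
    obtain ⟨ξ, hξS, -, hDξ⟩ := IsPermissibleCentre.exists_eq_singleton_of_isolatedSing (r.permissible k) ⟨hfin k, hcl k⟩
    exact ⟨ξ, hξS, hDξ⟩
  choose ξ hξS hDξ using hcentre
  -- the «lies over» relation on the tower of points (kept opaque: an `iff`-specified local predicate)
  obtain ⟨st, hst⟩ : ∃ st : (Σ k, (r.A k).Z) → (Σ k, (r.A k).Z) → Prop, ∀ a c, st a c ↔
      ∃ (k : ℕ) (y' : (r.A (k + 1)).Z), a = ⟨k + 1, y'⟩ ∧ c = ⟨k, (r.π k).base y'⟩ := ⟨_, fun _ _ => Iff.rfl⟩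
  have hst_mk : ∀ (k : ℕ) (y' : (r.A (k + 1)).Z), st ⟨k + 1, y'⟩ ⟨k, (r.π k).base y'⟩ :=
    fun k y' => (hst _ _).mpr ⟨k, y', rfl, rfl⟩
  have hst_fst : ∀ {a c}, st a c → a.1 = c.1 + 1 := by
    intro a c h
    obtain ⟨k, y', rfl, rfl⟩ := (hst _ _).mp h
    rfl
  have hst_det : ∀ {a c c'}, st a c → st a c' → c = c' := by
    intro a c c' h h'
    obtain ⟨k, y', rfl, rfl⟩ := (hst _ _).mp h
    obtain ⟨k', y'', h1, rfl⟩ := (hst _ _).mp h'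
    obtain ⟨hk, hy⟩ := Sigma.mk.inj_iff.mp h1
    obtain rfl : k = k' := by omega
    rw [eq_of_heq hy]
  have hst_tail : ∀ {c} {k : ℕ} {y : (r.A k).Z}, st c ⟨k, y⟩ → ∃ y' : (r.A (k + 1)).Z, c = ⟨k + 1, y'⟩ ∧ (r.π k).base y' = y := by
    intro c k y h
    obtain ⟨j, y'', rfl, h1⟩ := (hst _ _).mp h
    obtain ⟨hk, hy⟩ := Sigma.mk.inj_iff.mp h1
    subst hk
    exact ⟨y'', rfl, (eq_of_heq hy).symm⟩
  -- `Over a c := ReflTransGen st a c`: `c` is the image of `a` down the tower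
  have hO_le : ∀ {a c}, Relation.ReflTransGen st a c → c.1 ≤ a.1 := by
    intro a c h
    induction h with
    | refl => exact le_rfl
    | tail _ hs ih => have := hst_fst hs; omega
  have hO_eq : ∀ {a c}, Relation.ReflTransGen st a c → a.1 = c.1 → a = c := by
    intro a c h heq
    rcases h.cases_head with h1 | ⟨d, hd, hdc⟩
    · exact h1
    · exfalso; have h1 := hst_fst hd; have h2 := hO_le hdc; omega
  have hO_nested : ∀ {a c c'}, Relation.ReflTransGen st a c → Relation.ReflTransGen st a c' → c'.1 ≤ c.1 →
      Relation.ReflTransGen st c c' := by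
    intro a c c' h
    induction h using Relation.ReflTransGen.head_induction_on with
    | refl => intro h' _; exact h'
    | head hs htail ih =>
      intro h' hle
      rcases h'.cases_head with h1 | ⟨d', hd', hdc'⟩
      · exfalso
        have h1' := hst_fst hs; have h2 := hO_le htail
        rw [h1] at h1'
        omega
      · rw [hst_det hs hd'] at htail ih
        exact ih hdc' hle
  have hO_proj : ∀ (m k : ℕ), k ≤ m → ∀ z : (r.A m).Z, ∃ y : (r.A k).Z,
      Relation.ReflTransGen st (⟨m, z⟩ : Σ k, (r.A k).Z) ⟨k, y⟩ := by
    intro m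
    induction m with
    | zero =>
      intro k hk z
      obtain rfl : k = 0 := by omega
      exact ⟨z, Relation.ReflTransGen.refl⟩
    | succ m ih =>
      intro k hk z
      by_cases hkm : k = m + 1
      · subst hkm; exact ⟨z, Relation.ReflTransGen.refl⟩
      · obtain ⟨y, hy⟩ := ih k (by omega) ((r.π m).base z)
        exact ⟨y, Relation.ReflTransGen.head (hst_mk m z) hy⟩
  -- singularity descends along `Over` (an opaque predicate on the tower to keep unification syntactic)
  obtain ⟨Sg, hSg⟩ : ∃ Sg : (Σ k, (r.A k).Z) → Prop, ∀ (k : ℕ) (y : (r.A k).Z), Sg ⟨k, y⟩ ↔ y ∈ (r.E k).sing :=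
    ⟨fun a => a.2 ∈ (r.E a.1).sing, fun _ _ => Iff.rfl⟩
  have hO_singS : ∀ {a c}, Relation.ReflTransGen st a c → Sg a → Sg c := by
    intro a c h
    induction h using Relation.ReflTransGen.head_induction_on with
    | refl => exact id
    | head hs _ ih =>
      intro ha
      obtain ⟨k, y', rfl, rfl⟩ := (hst _ _).mp hs
      exact ih ((hSg _ _).mpr (r.base_mem_sing k ((hSg _ _).mp ha)))
  have hO_sing : ∀ {m k : ℕ} {z : (r.A m).Z} {y : (r.A k).Z},
      Relation.ReflTransGen st (⟨m, z⟩ : Σ k, (r.A k).Z) ⟨k, y⟩ → z ∈ (r.E m).sing → y ∈ (r.E k).sing :=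
    fun h hz => (hSg _ _).mp (hO_singS h ((hSg _ _).mpr hz))
  -- `T k`: the singular points of stage `k` under infinitely many later centres (opaque, `iff`-specified)
  obtain ⟨T, hT⟩ : ∃ T : ∀ k, Set (r.A k).Z, ∀ (k : ℕ) (y : (r.A k).Z), y ∈ T k ↔
      y ∈ (r.E k).sing ∧ {m | Relation.ReflTransGen st (⟨m, ξ m⟩ : Σ k, (r.A k).Z) ⟨k, y⟩}.Infinite :=
    ⟨fun k => {y | y ∈ (r.E k).sing ∧ {m | Relation.ReflTransGen st (⟨m, ξ m⟩ : Σ k, (r.A k).Z) ⟨k, y⟩}.Infinite},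
      fun _ _ => Iff.rfl⟩
  have hT_fin : ∀ k, (T k).Finite := fun k => (hfin k).subset fun y hy => ((hT _ _).mp hy).1
  have hT_sing : ∀ {k} {y : (r.A k).Z}, y ∈ T k → y ∈ (r.E k).sing := fun hy => ((hT _ _).mp hy).1
  have hT_down : ∀ {m k : ℕ} {z : (r.A m).Z} {y : (r.A k).Z},
      Relation.ReflTransGen st (⟨m, z⟩ : Σ k, (r.A k).Z) ⟨k, y⟩ → z ∈ T m → y ∈ T k := by
    intro m k z y h hz
    obtain ⟨hzS, hinf⟩ := (hT _ _).mp hz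
    exact (hT _ _).mpr ⟨hO_sing h hzS, hinf.mono fun n hn => hn.trans h⟩
  have hT_ne : ∀ k, (T k).Nonempty := by
    intro k
    haveI : Finite (r.E k).sing := (hfin k).to_subtype
    have hf : ∀ j : ℕ, ∃ y : (r.E k).sing, Relation.ReflTransGen st (⟨k + j, ξ (k + j)⟩ : Σ k, (r.A k).Z) ⟨k, y.1⟩ := by
      intro j
      obtain ⟨y, hy⟩ := hO_proj (k + j) k (Nat.le_add_right k j) (ξ (k + j))
      have hyS : y ∈ (r.E k).sing := hO_sing hy (hξS (k + j))
      exact ⟨⟨y, hyS⟩, hy⟩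
    choose f hf using hf
    obtain ⟨y, hy'⟩ := Finite.exists_infinite_fiber f
    have hy : (f ⁻¹' {y}).Infinite := Set.infinite_coe_iff.mp hy'
    refine ⟨y.1, (hT _ _).mpr ⟨y.2, ?_⟩⟩
    have hinj : Set.InjOn (fun j => k + j) (f ⁻¹' {y}) := fun j _ j' _ h => by
      have h' : k + j = k + j' := h
      omega
    refine (hy.image hinj).mono ?_
    rintro m ⟨j, hj, rfl⟩
    have hjy : f j = y := hj
    have := hf j
    rw [hjy] at this
    exact this
  -- pigeonhole: a finite set of stage `k` hit from every later `T n` contains an «immortal» element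
  have hpigeon : ∀ (k : ℕ) (C : Set (r.A k).Z), C.Finite →
      (∀ j : ℕ, ∃ z, z ∈ T (k + j) ∧ ∃ c ∈ C, Relation.ReflTransGen st (⟨k + j, z⟩ : Σ k, (r.A k).Z) ⟨k, c⟩) →
      ∃ c ∈ C, ∀ n, k ≤ n → ∃ z, z ∈ T n ∧ Relation.ReflTransGen st (⟨n, z⟩ : Σ k, (r.A k).Z) ⟨k, c⟩ := by
    intro k C hC h
    choose z hzT c hcC hzc using h
    haveI : Finite C := hC.to_subtype
    obtain ⟨c₀, hc₀'⟩ := Finite.exists_infinite_fiber (fun j => (⟨c j, hcC j⟩ : C))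
    have hc₀ : ((fun j => (⟨c j, hcC j⟩ : C)) ⁻¹' {c₀}).Infinite := Set.infinite_coe_iff.mp hc₀'
    refine ⟨c₀.1, c₀.2, fun n hn => ?_⟩
    obtain ⟨j, hj, hnj⟩ := hc₀.exists_gt n
    have hcj : c j = c₀.1 := by
      have : (⟨c j, hcC j⟩ : C) = c₀ := hj
      exact congrArg Subtype.val this
    obtain ⟨w, hw⟩ := hO_proj (k + j) n (by omega) (z j)
    refine ⟨w, hT_down hw (hzT j), ?_⟩
    rw [← hcj]
    exact hO_nested hw (hzc j) (by show k ≤ n; exact hn)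
  -- an immortal root
  have hroot : ∃ y, y ∈ T 0 ∧ ∀ n, 0 ≤ n → ∃ z, z ∈ T n ∧ Relation.ReflTransGen st (⟨n, z⟩ : Σ k, (r.A k).Z) ⟨0, y⟩ := by
    refine hpigeon 0 (T 0) (hT_fin 0) fun j => ?_
    obtain ⟨z, hz⟩ := hT_ne (0 + j)
    obtain ⟨c, hc⟩ := hO_proj (0 + j) 0 (Nat.zero_le _) z
    exact ⟨z, hz, c, hT_down hc hz, hc⟩
  -- an immortal element has an immortal child
  have hchild : ∀ (k : ℕ) (y : (r.A k).Z), y ∈ T k →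
      (∀ n, k ≤ n → ∃ z, z ∈ T n ∧ Relation.ReflTransGen st (⟨n, z⟩ : Σ k, (r.A k).Z) ⟨k, y⟩) →
      ∃ y', y' ∈ T (k + 1) ∧ (r.π k).base y' = y ∧
        ∀ n, k + 1 ≤ n → ∃ z, z ∈ T n ∧ Relation.ReflTransGen st (⟨n, z⟩ : Σ k, (r.A k).Z) ⟨k + 1, y'⟩ := by
    intro k y _ himm
    obtain ⟨c, ⟨hcT, hcπ⟩, hc⟩ := hpigeon (k + 1) {y' | y' ∈ T (k + 1) ∧ (r.π k).base y' = y}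
      ((hT_fin (k + 1)).subset fun y' hy' => hy'.1) fun j => by
        obtain ⟨z, hzT, hz⟩ := himm (k + 1 + j) (by omega)
        -- the path from stage `k + 1 + j` down to `k` passes through a child at stage `k + 1`
        rcases hz.cases_tail with h1 | ⟨c, hzc, hcst⟩
        · exfalso; have := congrArg Sigma.fst h1; simp only at this; omega
        · obtain ⟨y', rfl, hy'⟩ := hst_tail hcst
          exact ⟨z, hzT, y', ⟨hT_down hzc hzT, hy'⟩, hzc⟩
    exact ⟨c, hcT, hcπ, hc⟩
  -- the branch
  choose ch hchT hchπ hchI using hchild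
  obtain ⟨y₀, hy₀T, hy₀I⟩ := hroot
  let br : ∀ k, {y : (r.A k).Z // y ∈ T k ∧
      ∀ n, k ≤ n → ∃ z, z ∈ T n ∧ Relation.ReflTransGen st (⟨n, z⟩ : Σ k, (r.A k).Z) ⟨k, y⟩} :=
    fun k => Nat.rec (motive := fun k => {y : (r.A k).Z // y ∈ T k ∧
      ∀ n, k ≤ n → ∃ z, z ∈ T n ∧ Relation.ReflTransGen st (⟨n, z⟩ : Σ k, (r.A k).Z) ⟨k, y⟩})
      ⟨y₀, hy₀T, hy₀I⟩ (fun k yk => ⟨ch k yk.1 yk.2.1 yk.2.2, hchT k yk.1 yk.2.1 yk.2.2, hchI k yk.1 yk.2.1 yk.2.2⟩) k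
  have hbrT : ∀ k, (br k).1 ∈ T k := fun k => (br k).2.1
  have hbrπ : ∀ k, (r.π k).base (br (k + 1)).1 = (br k).1 := fun k => hchπ k (br k).1 (br k).2.1 (br k).2.2
  refine ⟨fun k => (br k).1, fun k => hT_sing (hbrT k), hbrπ, fun k₀ => ?_⟩
  -- the branch is hit by the centres infinitely often
  by_contra hno
  push Not at hno
  -- along a stretch avoiding the centres, everything over `b k` IS the branch
  have hpath : ∀ (a : Σ k, (r.A k).Z) (k : ℕ) (h : Relation.ReflTransGen st a ⟨k, (br k).1⟩), k₀ ≤ k →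
      (∀ j, k ≤ j → j < a.1 → (br j).1 ∉ (r.D j : Set (r.A j).Z)) → a = ⟨a.1, (br a.1).1⟩ := by
    intro a k h
    induction h using Relation.ReflTransGen.head_induction_on with
    | refl => intro _ _; rfl
    | @head a d hs hdO ih =>
      intro hk havoid
      obtain ⟨j, y', rfl, rfl⟩ := (hst _ _).mp hs
      have hd : (⟨j, (r.π j).base y'⟩ : Σ k, (r.A k).Z) = ⟨j, (br j).1⟩ :=
        ih hk fun i hi hij => havoid i hi (by have hij' : i < j := hij; show i < j + 1; omega)
      have hjy : (r.π j).base y' = (br j).1 := eq_of_heq (Sigma.mk.inj_iff.mp hd).2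
      have hkj : k ≤ j := by have := hO_le hdO; exact this
      have hnot : (br j).1 ∉ (r.D j : Set (r.A j).Z) := havoid j hkj (by show j < j + 1; omega)
      have hinj := MohWindow.injOn_preimage_compl (r.blowup j)
      have heq : y' = (br (j + 1)).1 := by
        refine hinj ?_ ?_ (hjy.trans (hbrπ j).symm)
        · show (r.π j).base y' ∈ (r.D j : Set (r.A j).Z)ᶜ
          rw [hjy]; exact hnot
        · show (r.π j).base (br (j + 1)).1 ∈ (r.D j : Set (r.A j).Z)ᶜ
          rw [hbrπ j]; exact hnot
      rw [heq]
  -- a later centre over `b k₀` would be a branch point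
  obtain ⟨m, hm, hk₀m⟩ := ((hT _ _).mp (hbrT k₀)).2.exists_gt k₀
  have hξm : (⟨m, ξ m⟩ : Σ k, (r.A k).Z) = ⟨m, (br m).1⟩ :=
    hpath ⟨m, ξ m⟩ k₀ hm le_rfl fun j hj _ => hno j hj
  have : (br m).1 ∈ (r.D m : Set (r.A m).Z) := by
    rw [hDξ m, ← eq_of_heq (Sigma.mk.inj_iff.mp hξm).2]; exact Set.mem_singleton _
  exact hno m hk₀m.le this

end CampaignW46

end Summit.ResolutionOfSingularities.ResolutionOfSingularities.Theorems

end
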